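import Mathlib
import HarnessLib
import Literature.AlgebraicGeometry.Resolution.AffineBlowup
import Summits.ResolutionOfSingularities.ResolutionOfSingularities.Theorems.WildQuotientsWildQuotientResolutionJordanFiveFrameDefs
import Summits.ResolutionOfSingularities.ResolutionOfSingularities.Theorems.WildQuotientsWildQuotientResolutionJordanFiveTwistedChartDefs

/-!
# RUNG V5 (J₅): the W₂ TERM OF RECORD `chartW₂ = D₊(i₂³t · (2j₃)²t) = D₊(i₂³t) ⊓ D₊((2j₃)²t)` of `Bl_{I₁₂} 𝔸ⁿ` (the `μ₂`-HIGH vertex open)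

(crux stmt-ResolutionOfSingularities-15640 `WildQuotients.WildQuotientResolution`, line `Sketch`;
chain w45c RUNG V5 `JordanFive.jordanFive_hasResolution_of_bricks` (res-L1-w45c-lead-1 BRICK LIST v1
2026-08-27T10:32:12Z, brick `W₂` / HP₂ = B7), res-L1-w45c-plan-1 RULINGs 11:08Z/11:12Z («stub-1
names only the OPEN W₂ (D₊ of σ-invariant Rees sections of I₁₂ ∋ C_c, missing C_a ∪ C_b; degrees +
invariance) + the twisted-root cover coordinates of RT-J5 §5»); design `L/res-L1-w45c-idea-2/RT-J5.md`
§5 (radicand `s² = R₂ = −j₃/i₂`, `Y₀ = x_a/s⁴, Y₁ = x_b/s³, u = x_c/s², Y₃ = x_d/s, Y₄ = x_e`) =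
res-type-036 PROPOSAL (α) 2026-08-27T11:25:02Z (cover `F = 2I + J = 0`, `I = i₂/s⁴`, `J = 2j₃/s⁶`).
Pattern of `…JordanFourChartWDefs` / `…JordanFiveChartW1Defs`. [OURS · L1 W4.5c] — NOT a statement
of any manuscript (Hironaka 2017 is consumed nowhere); replaces the role of no printed item. Prover
res-L1-w45c-stub-1. AI-written Lean, kernel-checked; weaker than expert review.)

`I₁₂ = JordanFive.I12 = ⟨gens12⟩` (p523816), `i₂ = JordanFive.iTwo`, `2j₃ = JordanFive.jThreeTwo`
(p521874; `σ`-invariant for the J₅ law: `JordanFive.map_iTwo`, `JordanFive.map_jThreeTwo`, p522729;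
weights `4` and `6`). At the `μ₂`-vertex curve `C_c` (root `ν² = x_c`): `i₂/ν⁴ → 1`, `2j₃/ν⁶ → −2`,
so BOTH `i₂³ t` and `(2j₃)² t` generate the centre near `C_c` (`char k ≠ 2`) and `C_c ⊆ W₂`; at `C_b`
`i₂/m⁴ → 0` (`HB₂`), at `C_a` `2j₃/ρ⁶ → 0` (`HA₂`; NB `i₂/ρ⁴ → 2x_e` does NOT vanish there — the
second section is what cuts `C_a` out). On the twisted-root cover `s² = −j₃/i₂` the degree-`0`
functions `u = x_c/s² = −x_c·i₂·(2j₃)·2/(2j₃)²`, `Y₀ = 4x_a i₂²/(2j₃)²`, `θ₂ = (2j₃)²/i₂³ ↦ 4/I`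
are regular on `W₂`; `Γ(W₂)`-level identification and the exit HP₂ are res-type-036's
(`…InvolutionKLTwice`, K–L twice), the stability/affinity/seam bricks res-L1-w45c-stub-5's.
* `JordanFive.iTwo_cube_mem_I12`, `JordanFive.jThreeTwo_sq_mem_I12` (explicit `gens12`-certificates,
  one generator per monomial; `50` resp. `60` monomials of weight `≥ 12`);
* `JordanFive.chartW₂ := D₊(i₂³t · (2j₃)²t)`; `chartW₂_def`, `chartW₂_section_mem` (degree `1+1`),
  `coe_chartW₂_section`, `isAffineOpen_chartW₂` (brick `HW₂aff`), `chartW₂_eq_inf`.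
-/

-- single-problem summit: the doubled namespace component `ResolutionOfSingularities` is forced
set_option linter.dupNamespace false

noncomputable section

open MvPolynomial Polynomial AlgebraicGeometry Literature.AlgebraicGeometry.Resolution

namespace Summit.ResolutionOfSingularities.ResolutionOfSingularities.Theorems.WildQuotientResolution.JordanFive

variable (k : Type) [Field k] (n : ℕ) (a b c d e : Fin n)

/-- **`i₂³ ∈ I₁₂`** (every monomial of `i₂` has `(4,3,2,1,0)`-weight `≥ 4`; explicit certificate,
one generator of `gens12` per monomial of `i₂³`). [OURS · L1 W4.5c] -/
theorem iTwo_cube_mem_I12 : iTwo k n a b c d e ^ 3 ∈ I12 k n a b c d := by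
  have hg := gens12_mem_I12 k n a b c d
  have g0 : gens12 k n a b c d 0 = X a ^ 3 := by simp [gens12]
  have g2 : gens12 k n a b c d 2 = X c ^ 6 := by simp [gens12]
  have g4 : gens12 k n a b c d 4 = X a ^ 2 * X b * X d := by simp [gens12]
  have g5 : gens12 k n a b c d 5 = X a ^ 2 * X c ^ 2 := by simp [gens12]
  have g8 : gens12 k n a b c d 8 = X a * X b ^ 2 * X c := by simp [gens12]
  have g9 : gens12 k n a b c d 9 = X a * X b ^ 2 * X d ^ 2 := by simp [gens12]
  have g10 : gens12 k n a b c d 10 = X a * X b * X c ^ 2 * X d := by simp [gens12]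
  have g13 : gens12 k n a b c d 13 = X a * X c ^ 4 := by simp [gens12]
  have g18 : gens12 k n a b c d 18 = X b ^ 3 * X c * X d := by simp [gens12]
  have g19 : gens12 k n a b c d 19 = X b ^ 3 * X d ^ 3 := by simp [gens12]
  have g20 : gens12 k n a b c d 20 = X b ^ 2 * X c ^ 3 := by simp [gens12]
  have g21 : gens12 k n a b c d 21 = X b ^ 2 * X c ^ 2 * X d ^ 2 := by simp [gens12]
  have g24 : gens12 k n a b c d 24 = X b * X c ^ 4 * X d := by simp [gens12]
  have g34 : gens12 k n a b c d 34 = X a ^ 2 * X b * X c := by simp [gens12]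
  have g36 : gens12 k n a b c d 36 = X a * X b * X c ^ 3 := by simp [gens12]
  have g38 : gens12 k n a b c d 38 = X b * X c ^ 5 := by simp [gens12]
  have e : iTwo k n a b c d e ^ 3 =
      ((8 : MvPolynomial (Fin n) k) * (X e ^ 3) + (36 : MvPolynomial (Fin n) k) * (X d * X e ^ 2) + (54 : MvPolynomial (Fin n) k) * (X d ^ 2 * X e) + (27 : MvPolynomial (Fin n) k) * (X d ^ 3) + (12 : MvPolynomial (Fin n) k) * (X c * X e ^ 2) + (36 : MvPolynomial (Fin n) k) * (X c * X d * X e) + (27 : MvPolynomial (Fin n) k) * (X c * X d ^ 2) + (6 : MvPolynomial (Fin n) k) * (X c ^ 2 * X e) + (9 : MvPolynomial (Fin n) k) * (X c ^ 2 * X d) + (1 : MvPolynomial (Fin n) k) * (X c ^ 3)) * gens12 k n a b c d 0 +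
      ((1 : MvPolynomial (Fin n) k) * (1)) * gens12 k n a b c d 2 +
      ((-24 : MvPolynomial (Fin n) k) * (X e ^ 2) + (-72 : MvPolynomial (Fin n) k) * (X d * X e) + (-54 : MvPolynomial (Fin n) k) * (X d ^ 2) + (-60 : MvPolynomial (Fin n) k) * (X c * X e) + (-63 : MvPolynomial (Fin n) k) * (X c * X d) + (-24 : MvPolynomial (Fin n) k) * (X c ^ 2)) * gens12 k n a b c d 4 +
      ((12 : MvPolynomial (Fin n) k) * (X e ^ 2) + (36 : MvPolynomial (Fin n) k) * (X d * X e) + (27 : MvPolynomial (Fin n) k) * (X d ^ 2) + (12 : MvPolynomial (Fin n) k) * (X c * X e) + (18 : MvPolynomial (Fin n) k) * (X c * X d) + (3 : MvPolynomial (Fin n) k) * (X c ^ 2) + (-12 : MvPolynomial (Fin n) k) * (X b * X e) + (-3 : MvPolynomial (Fin n) k) * (X b * X c)) * gens12 k n a b c d 5 +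
      ((24 : MvPolynomial (Fin n) k) * (X d * X e) + (48 : MvPolynomial (Fin n) k) * (X d ^ 2) + (6 : MvPolynomial (Fin n) k) * (X c * X e) + (21 : MvPolynomial (Fin n) k) * (X c * X d) + (3 : MvPolynomial (Fin n) k) * (X c ^ 2)) * gens12 k n a b c d 8 +
      ((24 : MvPolynomial (Fin n) k) * (X e) + (36 : MvPolynomial (Fin n) k) * (X d)) * gens12 k n a b c d 9 +
      ((-24 : MvPolynomial (Fin n) k) * (X e) + (-36 : MvPolynomial (Fin n) k) * (X d) + (-30 : MvPolynomial (Fin n) k) * (X c)) * gens12 k n a b c d 10 +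
      ((6 : MvPolynomial (Fin n) k) * (X e) + (9 : MvPolynomial (Fin n) k) * (X d) + (3 : MvPolynomial (Fin n) k) * (X c) + (-6 : MvPolynomial (Fin n) k) * (X b)) * gens12 k n a b c d 13 +
      ((-12 : MvPolynomial (Fin n) k) * (X d) + (-6 : MvPolynomial (Fin n) k) * (X c)) * gens12 k n a b c d 18 +
      ((-8 : MvPolynomial (Fin n) k) * (1)) * gens12 k n a b c d 19 +
      ((12 : MvPolynomial (Fin n) k) * (X d) + (3 : MvPolynomial (Fin n) k) * (X c) + (-1 : MvPolynomial (Fin n) k) * (X b)) * gens12 k n a b c d 20 +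
      ((12 : MvPolynomial (Fin n) k) * (1)) * gens12 k n a b c d 21 +
      ((-6 : MvPolynomial (Fin n) k) * (1)) * gens12 k n a b c d 24 +
      ((-12 : MvPolynomial (Fin n) k) * (X e ^ 2)) * gens12 k n a b c d 34 +
      ((-12 : MvPolynomial (Fin n) k) * (X e)) * gens12 k n a b c d 36 +
      ((-3 : MvPolynomial (Fin n) k) * (1)) * gens12 k n a b c d 38 := by
    rw [g0, g2, g4, g5, g8, g9, g10, g13, g18, g19, g20, g21, g24, g34, g36, g38]
    simp only [iTwo]
    ring
  rw [e]
  exact (Ideal.add_mem _ (Ideal.add_mem _ (Ideal.add_mem _ (Ideal.add_mem _ (Ideal.add_mem _ (Ideal.add_mem _ (Ideal.add_mem _ (Ideal.add_mem _ (Ideal.add_mem _ (Ideal.add_mem _ (Ideal.add_mem _ (Ideal.add_mem _ (Ideal.add_mem _ (Ideal.add_mem _ (Ideal.add_mem _ (Ideal.mul_mem_left _ _ (hg 0)) (Ideal.mul_mem_left _ _ (hg 2))) (Ideal.mul_mem_left _ _ (hg 4))) (Ideal.mul_mem_left _ _ (hg 5))) (Ideal.mul_mem_left _ _ (hg 8)))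 (Ideal.mul_mem_left _ _ (hg 9))) (Ideal.mul_mem_left _ _ (hg 10))) (Ideal.mul_mem_left _ _ (hg 13))) (Ideal.mul_mem_left _ _ (hg 18))) (Ideal.mul_mem_left _ _ (hg 19))) (Ideal.mul_mem_left _ _ (hg 20))) (Ideal.mul_mem_left _ _ (hg 21))) (Ideal.mul_mem_left _ _ (hg 24))) (Ideal.mul_mem_left _ _ (hg 34))) (Ideal.mul_mem_left _ _ (hg 36))) (Ideal.mul_mem_left _ _ (hg 38)))

/-- **`(2j₃)² ∈ I₁₂`** (every monomial of `2j₃` has weight `≥ 6`; explicit certificate).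
[OURS · L1 W4.5c] -/
theorem jThreeTwo_sq_mem_I12 : jThreeTwo k n a b c d e ^ 2 ∈ I12 k n a b c d := by
  have hg := gens12_mem_I12 k n a b c d
  have g1 : gens12 k n a b c d 1 = X b ^ 4 := by simp [gens12]
  have g2 : gens12 k n a b c d 2 = X c ^ 6 := by simp [gens12]
  have g4 : gens12 k n a b c d 4 = X a ^ 2 * X b * X d := by simp [gens12]
  have g5 : gens12 k n a b c d 5 = X a ^ 2 * X c ^ 2 := by simp [gens12]
  have g6 : gens12 k n a b c d 6 = X a ^ 2 * X c * X d ^ 2 := by simp [gens12]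
  have g7 : gens12 k n a b c d 7 = X a ^ 2 * X d ^ 4 := by simp [gens12]
  have g8 : gens12 k n a b c d 8 = X a * X b ^ 2 * X c := by simp [gens12]
  have g9 : gens12 k n a b c d 9 = X a * X b ^ 2 * X d ^ 2 := by simp [gens12]
  have g10 : gens12 k n a b c d 10 = X a * X b * X c ^ 2 * X d := by simp [gens12]
  have g11 : gens12 k n a b c d 11 = X a * X b * X c * X d ^ 3 := by simp [gens12]
  have g13 : gens12 k n a b c d 13 = X a * X c ^ 4 := by simp [gens12]
  have g14 : gens12 k n a b c d 14 = X a * X c ^ 3 * X d ^ 2 := by simp [gens12]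
  have g18 : gens12 k n a b c d 18 = X b ^ 3 * X c * X d := by simp [gens12]
  have g20 : gens12 k n a b c d 20 = X b ^ 2 * X c ^ 3 := by simp [gens12]
  have g21 : gens12 k n a b c d 21 = X b ^ 2 * X c ^ 2 * X d ^ 2 := by simp [gens12]
  have g24 : gens12 k n a b c d 24 = X b * X c ^ 4 * X d := by simp [gens12]
  have g34 : gens12 k n a b c d 34 = X a ^ 2 * X b * X c := by simp [gens12]
  have g35 : gens12 k n a b c d 35 = X a * X b ^ 3 := by simp [gens12]
  have g36 : gens12 k n a b c d 36 = X a * X b * X c ^ 3 := by simp [gens12]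
  have g37 : gens12 k n a b c d 37 = X b ^ 3 * X c ^ 2 := by simp [gens12]
  have g38 : gens12 k n a b c d 38 = X b * X c ^ 5 := by simp [gens12]
  have g39 : gens12 k n a b c d 39 = X a ^ 2 * X b ^ 2 := by simp [gens12]
  have e : jThreeTwo k n a b c d e ^ 2 =
      ((36 : MvPolynomial (Fin n) k) * (X e ^ 2) + (72 : MvPolynomial (Fin n) k) * (X d * X e) + (36 : MvPolynomial (Fin n) k) * (X d ^ 2) + (12 : MvPolynomial (Fin n) k) * (X c * X e) + (12 : MvPolynomial (Fin n) k) * (X c * X d) + (1 : MvPolynomial (Fin n) k) * (X c ^ 2)) * gens12 k n a b c d 1 +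
      ((4 : MvPolynomial (Fin n) k) * (1)) * gens12 k n a b c d 2 +
      ((-108 : MvPolynomial (Fin n) k) * (X d * X e) + (-108 : MvPolynomial (Fin n) k) * (X d ^ 2) + (144 : MvPolynomial (Fin n) k) * (X c * X e) + (-18 : MvPolynomial (Fin n) k) * (X c * X d) + (-24 : MvPolynomial (Fin n) k) * (X c ^ 2) + (72 : MvPolynomial (Fin n) k) * (X b * X e) + (36 : MvPolynomial (Fin n) k) * (X b * X d) + (12 : MvPolynomial (Fin n) k) * (X b * X c)) * gens12 k n a b c d 4 +
      ((144 : MvPolynomial (Fin n) k) * (X e ^ 2) + (36 : MvPolynomial (Fin n) k) * (X d ^ 2) + (-48 : MvPolynomial (Fin n) k) * (X c * X e) + (4 : MvPolynomial (Fin n) k) * (X c ^ 2) + (-4 : MvPolynomial (Fin n) k) * (X b * X c) + (1 : MvPolynomial (Fin n) k) * (X b ^ 2)) * gens12 k n a b c d 5 +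
      ((-216 : MvPolynomial (Fin n) k) * (X e)) * gens12 k n a b c d 6 +
      ((81 : MvPolynomial (Fin n) k) * (1)) * gens12 k n a b c d 7 +
      ((-144 : MvPolynomial (Fin n) k) * (X e ^ 2) + (-72 : MvPolynomial (Fin n) k) * (X d * X e) + (90 : MvPolynomial (Fin n) k) * (X d ^ 2) + (36 : MvPolynomial (Fin n) k) * (X c * X e) + (72 : MvPolynomial (Fin n) k) * (X c * X d) + (10 : MvPolynomial (Fin n) k) * (X c ^ 2) + (-24 : MvPolynomial (Fin n) k) * (X b * X e) + (-24 : MvPolynomial (Fin n) k) * (X b * X d) + (-2 : MvPolynomial (Fin n) k) * (X b * X c) + (12 : MvPolynomial (Fin n) k) * (X a * X e)) * gens12 k n a b c d 8 +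
      ((108 : MvPolynomial (Fin n) k) * (X e) + (108 : MvPolynomial (Fin n) k) * (X d) + (-72 : MvPolynomial (Fin n) k) * (X b)) * gens12 k n a b c d 9 +
      ((144 : MvPolynomial (Fin n) k) * (X e) + (-54 : MvPolynomial (Fin n) k) * (X d) + (-48 : MvPolynomial (Fin n) k) * (X c)) * gens12 k n a b c d 10 +
      ((-108 : MvPolynomial (Fin n) k) * (1)) * gens12 k n a b c d 11 +
      ((-48 : MvPolynomial (Fin n) k) * (X e) + (8 : MvPolynomial (Fin n) k) * (X c) + (-16 : MvPolynomial (Fin n) k) * (X b)) * gens12 k n a b c d 13 +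
      ((36 : MvPolynomial (Fin n) k) * (1)) * gens12 k n a b c d 14 +
      ((-72 : MvPolynomial (Fin n) k) * (X e) + (-72 : MvPolynomial (Fin n) k) * (X d) + (-48 : MvPolynomial (Fin n) k) * (X c)) * gens12 k n a b c d 18 +
      ((24 : MvPolynomial (Fin n) k) * (X e) + (60 : MvPolynomial (Fin n) k) * (X d) + (13 : MvPolynomial (Fin n) k) * (X c) + (-6 : MvPolynomial (Fin n) k) * (X b)) * gens12 k n a b c d 20 +
      ((36 : MvPolynomial (Fin n) k) * (1)) * gens12 k n a b c d 21 +
      ((-24 : MvPolynomial (Fin n) k) * (1)) * gens12 k n a b c d 24 +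
      ((144 : MvPolynomial (Fin n) k) * (X e ^ 2)) * gens12 k n a b c d 34 +
      ((-72 : MvPolynomial (Fin n) k) * (X e ^ 2) + (-144 : MvPolynomial (Fin n) k) * (X d * X e)) * gens12 k n a b c d 35 +
      ((48 : MvPolynomial (Fin n) k) * (X e)) * gens12 k n a b c d 36 +
      ((-36 : MvPolynomial (Fin n) k) * (X e)) * gens12 k n a b c d 37 +
      ((-12 : MvPolynomial (Fin n) k) * (1)) * gens12 k n a b c d 38 +
      ((36 : MvPolynomial (Fin n) k) * (X e ^ 2)) * gens12 k n a b c d 39 := by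
    rw [g1, g2, g4, g5, g6, g7, g8, g9, g10, g11, g13, g14, g18, g20, g21, g24, g34, g35, g36, g37, g38, g39]
    simp only [jThreeTwo]
    ring
  rw [e]
  exact (Ideal.add_mem _ (Ideal.add_mem _ (Ideal.add_mem _ (Ideal.add_mem _ (Ideal.add_mem _ (Ideal.add_mem _ (Ideal.add_mem _ (Ideal.add_mem _ (Ideal.add_mem _ (Ideal.add_mem _ (Ideal.add_mem _ (Ideal.add_mem _ (Ideal.add_mem _ (Ideal.add_mem _ (Ideal.add_mem _ (Ideal.add_mem _ (Ideal.add_mem _ (Ideal.add_mem _ (Ideal.add_mem _ (Ideal.add_mem _ (Ideal.add_mem _ (Ideal.mul_mem_left _ _ (hg 1)) (Ideal.mul_mem_left _ _ (hg 2))) (Ideal.mul_mem_left _ _ (hg 4))) (Ideal.mul_mem_left _ _ (hg 5))) (Ideal.mul_mem_left _ _ (hg 6))) (Ideal.mul_mem_left _ _ (hg 7))) (Ideal.mul_mem_left _ _ (hg 8))) (Ideal.mul_mem_left _ _ (hg 9))) (Ideal.mul_mem_left _ _ (hg 10))) (Ideal.mul_mem_left _ _ (hg 11))) (Ideal.mul_mem_left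 _ _ (hg 13))) (Ideal.mul_mem_left _ _ (hg 14))) (Ideal.mul_mem_left _ _ (hg 18))) (Ideal.mul_mem_left _ _ (hg 20))) (Ideal.mul_mem_left _ _ (hg 21))) (Ideal.mul_mem_left _ _ (hg 24))) (Ideal.mul_mem_left _ _ (hg 34))) (Ideal.mul_mem_left _ _ (hg 35))) (Ideal.mul_mem_left _ _ (hg 36))) (Ideal.mul_mem_left _ _ (hg 37))) (Ideal.mul_mem_left _ _ (hg 38))) (Ideal.mul_mem_left _ _ (hg 39)))

/-- **The W₂ TERM OF RECORD**: `chartW₂ = D₊(i₂³t · (2j₃)²t) ⊆ Bl_{I₁₂} 𝔸ⁿ = Proj R[I₁₂t]` — the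
twisted-root open at the `μ₂`-HIGH vertex `C_c` (`s² = −j₃/i₂`; RT-J5 §5). [OURS · L1 W4.5c] -/
def chartW₂ : (affineBlowup (I12 k n a b c d)).Opens :=
  Proj.basicOpen (reesGrading _)
    (reesT (iTwo k n a b c d e ^ 3) (iTwo_cube_mem_I12 k n a b c d e) *
      reesT (jThreeTwo k n a b c d e ^ 2) (jThreeTwo_sq_mem_I12 k n a b c d e))

/-- Unfolding `chartW₂`. [folklore] -/
theorem chartW₂_def : chartW₂ k n a b c d e = Proj.basicOpen (reesGrading _)
    (reesT (iTwo k n a b c d e ^ 3) (iTwo_cube_mem_I12 k n a b c d e) *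
      reesT (jThreeTwo k n a b c d e ^ 2) (jThreeTwo_sq_mem_I12 k n a b c d e)) :=
  rfl

/-- The section `i₂³t · (2j₃)²t` is homogeneous of degree `2`. [folklore] -/
theorem chartW₂_section_mem :
    reesT (iTwo k n a b c d e ^ 3) (iTwo_cube_mem_I12 k n a b c d e) *
        reesT (jThreeTwo k n a b c d e ^ 2) (jThreeTwo_sq_mem_I12 k n a b c d e) ∈
      reesGrading (I12 k n a b c d) (1 + 1) :=
  SetLike.mul_mem_graded (reesT_mem _ _) (reesT_mem _ _)

/-- The underlying polynomial of the section: `(i₂³ · (2j₃)²) t²`. [folklore] -/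
theorem coe_chartW₂_section :
    ((reesT (iTwo k n a b c d e ^ 3) (iTwo_cube_mem_I12 k n a b c d e) *
        reesT (jThreeTwo k n a b c d e ^ 2) (jThreeTwo_sq_mem_I12 k n a b c d e) :
      reesAlgebra (I12 k n a b c d)) : (MvPolynomial (Fin n) k)[X]) =
      monomial 2 (iTwo k n a b c d e ^ 3 * jThreeTwo k n a b c d e ^ 2) := by
  change (monomial 1 (iTwo k n a b c d e ^ 3)) * (monomial 1 (jThreeTwo k n a b c d e ^ 2)) = _
  rw [monomial_mul_monomial]

/-- **Brick `HW₂aff`: `chartW₂` is an affine open** (`Proj.isAffineOpen_basicOpen`).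
[OURS · L1 W4.5c] -/
theorem isAffineOpen_chartW₂ : IsAffineOpen (chartW₂ k n a b c d e) :=
  Proj.isAffineOpen_basicOpen _ _ (chartW₂_section_mem k n a b c d e) (by norm_num)

/-- **`chartW₂ = D₊(i₂³t) ⊓ D₊((2j₃)²t)`.** [OURS · L1 W4.5c] -/
theorem chartW₂_eq_inf : chartW₂ k n a b c d e =
    Proj.basicOpen (reesGrading _) (reesT (iTwo k n a b c d e ^ 3) (iTwo_cube_mem_I12 k n a b c d e)) ⊓
      Proj.basicOpen (reesGrading _)
        (reesT (jThreeTwo k n a b c d e ^ 2) (jThreeTwo_sq_mem_I12 k n a b c d e)) :=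
  Proj.basicOpen_mul _ _ _

end Summit.ResolutionOfSingularities.ResolutionOfSingularities.Theorems.WildQuotientResolution.JordanFive

end
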